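import Literature.Geometry.Lorentzian.CarterThresholdTurningPointTortoise
import Literature.Geometry.Lorentzian.CarterThresholdBarrierConstants
import HarnessLib

/-!
# Geometry of the threshold barrier of Carter's equation in Breitenlohner–Freedman stable sectors:
# the points, floors and layer of the one-barrier kernel bound, with monomial constants
(namespace `Literature.Geometry.Lorentzian.Kerr`.)

Carter's radial equation `u″ + φu = 0`, `φ = ω² − V∘ρ` (`V = Kerr.sepPotential M a ω m Λ`, `ρ` a
tortoise radius; DRSR arXiv:1402.7034 §5.2.3) AT THE SUPERRADIANT THRESHOLD `ω = mω₊ ≠ 0` of a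
sub-extremal Kerr exterior, in a Breitenlohner–Freedman stable sector with margin
`(1 + θ₁)(2r₊ω)² ≤ Λ′` (`Λ′ = Λ − 2amω`, `0 < θ₁ ≤ 1`), near extremality (`r₊ − r₋ ≤ θ₁M/4`) and for
`Λ′ ≥ 2.5·10¹⁰/θ₁³`. GIVEN the census (`{r > r₊ : ω² ≤ V r}` order-connected), this file assembles the
landed pieces — the forbidden half-line `(−∞, b₂]` (`CarterThresholdBarrier`), the profile zero `r_t`
and the affine control of `q = V∘ρ − ω²` before `b₂` (`CarterThresholdTurningPoint(Tortoise)`), the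
monomial arithmetic (`CarterThresholdBarrierConstants`) — into the structural input of the generic
one-barrier kernel bound (`Literature.Analysis.ODE.oneBarrier_kernel_le`):

* `IsTortoiseRadius.apply_sub_apply_le_sub` — tortoise distances dominate radial ones (`ρ′ ≤ 1`);
* `negCoeff_ge_of_collar` — the collar floor: for `r₊ < r_θ ≤ r ≤ r_lo ≤ r_t` (`J(r_t) = 0`),
  `V(r) − ω² ≥ Δ(r_θ)·2ω²(r_lo + r₊)h_lo(r_t − r_lo)/(r_lo² + a²)²`;
* `threshold_barrier_geometry` — there are `b₂, s_θ, s_lo, s_mid, L, K_L, k₀, k₁` with: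
  `{φ ≤ 0} = (−∞, b₂]`, `φ b₂ = 0`, `ρ b₂ < R = max(7M, √(12Λ)/|ω|, 1/(Mω²))`, `ρ b₂ ≥ (1 + θ₁/2)r₊`;
  `ρ s_θ = r₊ + θ(r₊ − r₋)` (any collar `θ > 0` with `θ(r₊ − r₋) ≤ θ₁M/4`), `s_θ ≤ s_lo < s_mid ≤ b₂ − L`,
  `L > 0`; floors `q ≥ k₀² > 0` on `[s_θ, b₂ − L]`, `q ≥ k₁² > 0` on `[s_lo, s_mid]`; layer
  `|q| ≤ K_L²` on `[b₂ − L, b₂]`, `K_L L ≤ 1`; and the MONOMIAL bookkeeping facts (`δ := ρ b₂ − r₊`,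
  `r_b := ρ b₂`): `δ/4 ≤ s_mid − s_lo`, `ω²δ⁵/(1024 r_b⁵) ≤ k₁²`,
  `min(Δ(r_θ)ω²δ/(32r_b³), 3δ²/(4r_b⁴)) ≤ k₀²`, `3r_b/(ω²δ²) ≤ L ≤ 92160 r_b/(ω²δ²)`, `Λ′ ≤ 4ω²r_b²`.

(`s_lo, s_mid` are the tortoise preimages of `r₊ + δ/2`, `r₊ + 3δ/4`; `L = 2e₁/c₁` with the affine
constants `c₁, e₁` of `negCoeff_affine_bounds_tortoise_of_threshold`.) This is the geometric half of
the threshold cone kernel bound of the near-extremal Kerr programme (crux `KappaExplicitWaveDecay`,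
BF-stable large-`Λ`); the analytic half is `CarterThresholdKernelBound.threshold_kernel_le_of_barrier`.

## References
* M. Dafermos, I. Rodnianski, Y. Shlapentokh-Rothman, arXiv:1402.7034 = Ann. of Math. 183 (2016),
  §§5.2.3, 6.2–6.4 (key `DafermosRodnianskiShlapentokhrothman2014`).
* R. Teixeira da Costa, Commun. Math. Phys. 378 (2020), §2.2 (key `Costa2019`). The assembly is folklore.
-/

noncomputable section

open Set

namespace Literature.Geometry.Lorentzian

namespace Kerr

/-! ### Tortoise distances dominate radial distances -/

namespace IsTortoiseRadius

variable {M a : ℝ} {ρ : ℝ → ℝ}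

/-- For a tortoise radius `ρ` and `x ≤ y`: `ρ y − ρ x ≤ y − x` (`ρ′ = Δ/(ρ² + a²) ≤ 1` since
`Δ = ρ² − 2Mρ + a² ≤ ρ² + a²`). [cite: DafermosRodnianskiShlapentokhrothman2014, §2.1.2] -/
theorem apply_sub_apply_le_sub (hρ : IsTortoiseRadius M a ρ) (hMa : IsSubextremal M a) {x y : ℝ}
    (hxy : x ≤ y) : ρ y - ρ x ≤ y - x := by
  have hM : 0 < M := hMa.pos
  set g : ℝ → ℝ := fun s ↦ s - ρ s with hg
  have hderiv : ∀ s, HasDerivAt g (1 - delta M a (ρ s) / (ρ s ^ 2 + a ^ 2)) s := fun s ↦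
    (hasDerivAt_id s).sub (hρ.hasDerivAt s)
  have hmono : Monotone g := by
    refine monotone_of_hasDerivAt_nonneg (f' := fun s ↦ 1 - delta M a (ρ s) / (ρ s ^ 2 + a ^ 2))
      hderiv fun s ↦ ?_
    have hA : 0 < ρ s ^ 2 + a ^ 2 := hρ.sq_add_sq_pos hMa s
    have h1 : delta M a (ρ s) ≤ ρ s ^ 2 + a ^ 2 := by
      unfold delta; nlinarith [hρ.pos hMa s]
    have : delta M a (ρ s) / (ρ s ^ 2 + a ^ 2) ≤ 1 := (div_le_one hA).2 h1
    change (0 : ℝ) ≤ 1 - delta M a (ρ s) / (ρ s ^ 2 + a ^ 2)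
    linarith
  have := hmono hxy
  simp only [hg] at this
  linarith

end IsTortoiseRadius

/-! ### The collar floor -/

section Geometry

variable {M a ω Λ : ℝ} {m : ℤ} {ρ : ℝ → ℝ}

/-- **The collar floor of the threshold barrier.** At the threshold `ω = mω₊` (`|a| < M`), let
`J(r_t) = 0` and `r₊ < r_θ ≤ r ≤ r_lo ≤ r_t`. Then
`Δ(r_θ)·(2ω²(r_lo + r₊)h(r_lo)(r_t − r_lo))/(r_lo² + a²)² ≤ V(r) − ω²` (`(r² + a²)²(V − ω²) ≥ Δ(r)J(r)`,
`Δ(r) ≥ Δ(r_θ)`, `J(r) ≥ J(r_lo) ≥ 2ω²(r_lo + r₊)h(r_lo)(r_t − r_lo)`, `(r² + a²)² ≤ (r_lo² + a²)²`).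
[folklore] -/
theorem negCoeff_ge_of_collar (ha : |a| < M) (hωth : ω = m * horizonAngularVelocity M a)
    {rθ rlo rt r : ℝ} (hθ : rPlus M a < rθ) (hθr : rθ ≤ r) (hrlo : r ≤ rlo) (hlot : rlo ≤ rt)
    (hJrt : Λ - 2 * a * m * ω - ω ^ 2 * (rt + rPlus M a) ^ 2 * ((rt - rPlus M a) / (rt - rMinus M a)) = 0) :
    delta M a rθ * (2 * ω ^ 2 * (rlo + rPlus M a) * ((rlo - rPlus M a) / (rlo - rMinus M a)) *
        (rt - rlo)) / (rlo ^ 2 + a ^ 2) ^ 2 ≤ sepPotential M a ω m Λ r - ω ^ 2 := by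
  have hsub : IsSubextremal M a := ha
  have hM : 0 < M := hsub.pos
  have hrp : 0 < rPlus M a := rPlus_pos hM a
  have hr : rPlus M a < r := hθ.trans_le hθr
  have hrlo' : rPlus M a < rlo := hr.trans_le hrlo
  have hr0 : 0 < r := hrp.trans hr
  have hrlo0 : 0 < rlo := hrp.trans hrlo'
  have hA : 0 < (r ^ 2 + a ^ 2) ^ 2 := by positivity
  have hAlo : 0 < (rlo ^ 2 + a ^ 2) ^ 2 := by positivity
  set J : ℝ → ℝ := fun s ↦ Λ - 2 * a * m * ω -
    ω ^ 2 * (s + rPlus M a) ^ 2 * ((s - rPlus M a) / (s - rMinus M a)) with hJdef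
  set Jlo' := 2 * ω ^ 2 * (rlo + rPlus M a) * ((rlo - rPlus M a) / (rlo - rMinus M a)) * (rt - rlo)
    with hJlo'
  -- `J(r) ≥ J(r_lo) ≥ Jlo' ≥ 0`
  have h1 : Jlo' ≤ J rlo := by
    have h := thresholdProfile_sub_ge (ω := ω) (Λ := Λ) (m := m) ha hrlo' hlot
    have e : J rt = 0 := hJrt
    simp only [hJdef] at e ⊢
    linarith [h, e]
  have h2 : J rlo ≤ J r := by
    have h := thresholdProfile_sub_ge (ω := ω) (Λ := Λ) (m := m) ha hr hrlo
    have hrm : 0 < r - rMinus M a := by linarith [hsub.rMinus_lt_rPlus]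
    have h0 : 0 ≤ 2 * ω ^ 2 * (r + rPlus M a) * ((r - rPlus M a) / (r - rMinus M a)) * (rlo - r) :=
      mul_nonneg (mul_nonneg (mul_nonneg (by positivity) (by linarith))
        (div_nonneg (by linarith) hrm.le)) (by linarith)
    simp only [hJdef] at h ⊢
    linarith
  have hJlo0 : 0 ≤ Jlo' := by
    have hrm : 0 < rlo - rMinus M a := by linarith [hsub.rMinus_lt_rPlus]
    exact mul_nonneg (mul_nonneg (mul_nonneg (by positivity) (by linarith))
      (div_nonneg (by linarith) hrm.le)) (by linarith)
  -- `Δ(r) ≥ Δ(r_θ) ≥ 0`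
  have hΔθ : 0 ≤ delta M a rθ := delta_nonneg ha.le hθ.le
  have hΔ : delta M a rθ ≤ delta M a r := IsTortoiseRadius.delta_le_delta hsub hθ.le hθr
  -- the exact lower profile bound at `r`
  have hlow := (sq_mul_negCoeff_mem_Icc_of_threshold (Λ := Λ) ha hωth hr).1
  have h3 : delta M a rθ * Jlo' ≤ (r ^ 2 + a ^ 2) ^ 2 * (sepPotential M a ω m Λ r - ω ^ 2) := by
    calc delta M a rθ * Jlo' ≤ delta M a r * J r :=
          mul_le_mul hΔ (h1.trans h2) hJlo0 (hΔθ.trans hΔ)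
      _ ≤ _ := hlow
  -- divide
  have h4 : (r ^ 2 + a ^ 2) ^ 2 ≤ (rlo ^ 2 + a ^ 2) ^ 2 :=
    pow_le_pow_left₀ (by positivity) (by nlinarith) 2
  have h5 : delta M a rθ * Jlo' / (rlo ^ 2 + a ^ 2) ^ 2 ≤ delta M a rθ * Jlo' / (r ^ 2 + a ^ 2) ^ 2 :=
    div_le_div_of_nonneg_left (mul_nonneg hΔθ hJlo0) hA h4
  refine h5.trans ?_
  rw [div_le_iff₀ hA]
  linarith

/-! ### Radial data of the threshold barrier -/

/-- **Radial data of the threshold barrier** (census + margin + profile zero + largeness). Under the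
hypotheses of `threshold_barrier_geometry`: the forbidden half-line `(−∞, b₂]` with `φ b₂ = 0`,
`ρ b₂ < R`, `(1 + θ₁/2)r₊ ≤ ρ b₂`; the profile zero `r_t` with `r₊ − r₋ ≤ r_t − r₊`, `J(r_t) = 0`,
`r_t ≤ ρ b₂`, `ρ b₂ − r_t ≤ (ρ b₂ − r₊)/4`; the scale relation `Λ′ ≤ 4ω²(ρ b₂)²`; and the two
largeness facts `368640·ρ b₂ ≤ ω²δ³`, `1.36·10¹⁸ ≤ ω⁴δ³ρ b₂` (`δ = ρ b₂ − r₊`). [folklore] -/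
theorem threshold_barrier_radii (hρ : IsTortoiseRadius M a ρ) (hMa : IsSubextremal M a)
    (hadm : IsAdmissibleTriple a ω m Λ) (hωth : ω = m * horizonAngularVelocity M a) (hω : ω ≠ 0)
    {θ₁ : ℝ} (hθ₁ : 0 < θ₁) (hθ₁1 : θ₁ ≤ 1)
    (hBF : (1 + θ₁) * (2 * rPlus M a * ω) ^ 2 ≤ Λ - 2 * a * m * ω)
    (hd : rPlus M a - rMinus M a ≤ θ₁ * M / 4)
    (hΛ' : 2.5e10 / θ₁ ^ 3 ≤ Λ - 2 * a * m * ω)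
    (hord : (Ioi (rPlus M a) ∩ {r : ℝ | ω ^ 2 ≤ sepPotential M a ω m Λ r}).OrdConnected) :
    ∃ b₂ rt : ℝ,
      {s | ω ^ 2 - sepPotential M a ω m Λ (ρ s) ≤ 0} = Iic b₂ ∧
      ω ^ 2 - sepPotential M a ω m Λ (ρ b₂) = 0 ∧
      ρ b₂ < max (7 * M) (max (Real.sqrt (12 * Λ) / |ω|) (1 / (M * ω ^ 2))) ∧
      (1 + θ₁ / 2) * rPlus M a ≤ ρ b₂ ∧
      rPlus M a < rt ∧ rPlus M a - rMinus M a ≤ rt - rPlus M a ∧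
      Λ - 2 * a * m * ω - ω ^ 2 * (rt + rPlus M a) ^ 2 * ((rt - rPlus M a) / (rt - rMinus M a)) = 0 ∧
      rt ≤ ρ b₂ ∧ ρ b₂ - rt ≤ (ρ b₂ - rPlus M a) / 4 ∧
      Λ - 2 * a * m * ω ≤ 4 * ω ^ 2 * ρ b₂ ^ 2 ∧
      368640 * ρ b₂ ≤ ω ^ 2 * (ρ b₂ - rPlus M a) ^ 3 ∧
      1.36e18 ≤ ω ^ 4 * (ρ b₂ - rPlus M a) ^ 3 * ρ b₂ := by
  have ha : |a| < M := hMa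
  have hM : 0 < M := hMa.pos
  have hrp : 0 < rPlus M a := rPlus_pos hM a
  have hMr : M ≤ rPlus M a := M_le_rPlus M a
  have hd0 : 0 < rPlus M a - rMinus M a := sub_pos.2 hMa.rMinus_lt_rPlus
  have hω0 : 0 < |ω| := abs_pos.2 hω
  have hω2 : 0 < ω ^ 2 := by positivity
  have hθM : θ₁ * M ≤ θ₁ * rPlus M a := mul_le_mul_of_nonneg_left hMr hθ₁.le
  set Λ' := Λ - 2 * a * m * ω with hΛ'def
  -- strict BF stability from the margin
  have hBF4 : 4 * rPlus M a ^ 2 * ω ^ 2 < Λ' := by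
    have h1 : 0 < θ₁ * (4 * rPlus M a ^ 2 * ω ^ 2) := by positivity
    have e : (1 + θ₁) * (2 * rPlus M a * ω) ^ 2 = 4 * rPlus M a ^ 2 * ω ^ 2 +
      θ₁ * (4 * rPlus M a ^ 2 * ω ^ 2) := by ring
    linarith
  have hΛ'pos : 0 < Λ' := lt_of_le_of_lt (by positivity) hBF4
  -- the census
  obtain ⟨b₂, hb₂R, hF, hφb₂, hin⟩ := forbidden_interval_threshold hρ hMa hadm hωth hω hBF4 hord
  have hmargin : (1 + θ₁ / 2) * rPlus M a ≤ Real.sqrt Λ' / |ω| - rPlus M a :=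
    rPlus_mul_le_of_margin hω hθ₁.le (by linarith) hBF
  have hrb_lo : (1 + θ₁ / 2) * rPlus M a ≤ ρ b₂ :=
    hmargin.trans (le_rho_of_forbidden_threshold hρ hMa hω hin)
  set rb := ρ b₂ with hrbdef
  set δ := rb - rPlus M a with hδdef
  have hδlo : θ₁ * rPlus M a / 2 ≤ δ := by
    have e : (1 + θ₁ / 2) * rPlus M a = rPlus M a + θ₁ * rPlus M a / 2 := by ring
    rw [hδdef]; linarith
  have hδ : 0 < δ := lt_of_lt_of_le (by positivity) hδlo
  have hrb0 : 0 < rb := by linarith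
  -- the profile zero
  have hd2 : rPlus M a - rMinus M a ≤ rPlus M a / 2 := by
    have : θ₁ * M ≤ 1 * rPlus M a := hθM.trans (by nlinarith)
    linarith
  obtain ⟨rt, hrt, hrt1, hrt2, hJrt, -, -⟩ :=
    exists_thresholdProfile_zero (Λ := Λ) (m := m) ha hω hd2 hBF4
  have hrt_lo : (1 + θ₁ / 2) * rPlus M a ≤ rt := by linarith [hmargin, hrt1]
  have hrtd : rPlus M a - rMinus M a ≤ rt - rPlus M a := by
    have e : (1 + θ₁ / 2) * rPlus M a = rPlus M a + θ₁ * rPlus M a / 2 := by ring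
    linarith
  have hV : sepPotential M a ω m Λ (ρ b₂) = ω ^ 2 := by linarith
  obtain ⟨-, -, hrtb, h3⟩ :=
    thresholdProfile_turningRadius_le (Λ := Λ) ha hωth hω hrt hrtd hJrt (hρ.rPlus_lt b₂) hV
  -- `Λ′ ≤ ω²(r_t + r₊)² ≤ 4ω²r_b²`
  have hsq : Λ' ≤ ω ^ 2 * (rt + rPlus M a) ^ 2 := by
    have h1 : Real.sqrt Λ' ≤ (rt + rPlus M a) * |ω| := by rwa [div_le_iff₀ hω0] at hrt1
    have h2 : Real.sqrt Λ' ^ 2 ≤ ((rt + rPlus M a) * |ω|) ^ 2 :=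
      pow_le_pow_left₀ (Real.sqrt_nonneg _) h1 2
    rw [Real.sq_sqrt hΛ'pos.le, mul_pow, sq_abs] at h2
    linarith
  have hΛ4 : Λ' ≤ 4 * ω ^ 2 * rb ^ 2 := by
    have h1 : (rt + rPlus M a) ^ 2 ≤ (2 * rb) ^ 2 :=
      pow_le_pow_left₀ (by linarith) (by linarith) 2
    have h2 := mul_le_mul_of_nonneg_left h1 hω2.le
    have e : ω ^ 2 * (2 * rb) ^ 2 = 4 * ω ^ 2 * rb ^ 2 := by ring
    linarith
  -- largeness
  have hδθ : θ₁ * rb ≤ 3 * δ := by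
    have e : θ₁ * rb = θ₁ * rPlus M a + θ₁ * δ := by rw [hδdef]; ring
    have h1 : θ₁ * δ ≤ δ := mul_le_of_le_one_left hδ.le hθ₁1
    linarith
  obtain ⟨hbig1, hbig2⟩ := thresholdBarrier_largeness_of_margin (ω := ω) hrb0 hθ₁ hθ₁1 hΛ4 hδθ hΛ'
  -- `r_b − r_t ≤ 3/(ω²(r_t + r₊)) ≤ 6r_b/Λ′ ≤ δ/4`
  have hgap : rb - rt ≤ δ / 4 := by
    have hrr : 0 < rt + rPlus M a := by linarith only [hrt, hrp]
    set X := ω ^ 2 * (rt + rPlus M a) with hX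
    have hX0 : 0 < X := mul_pos hω2 hrr
    have s1 : rb - rt ≤ 3 / X := by rw [le_div_iff₀ hX0]; linarith only [h3]
    have h2 : Λ' ≤ 2 * rb * X := by
      have h4 : rt + rPlus M a ≤ 2 * rb := by linarith only [hrtb, hrbdef, hδ, hδdef]
      have h5 : X * (rt + rPlus M a) ≤ X * (2 * rb) := mul_le_mul_of_nonneg_left h4 hX0.le
      have e : ω ^ 2 * (rt + rPlus M a) ^ 2 = X * (rt + rPlus M a) := by rw [hX]; ring
      linarith only [hsq, h5, e]
    have s2 : 3 / X ≤ 6 * rb / Λ' := by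
      rw [div_le_div_iff₀ hX0 hΛ'pos]; linarith only [h2]
    have h4 : 24 * rb ≤ Λ' * δ := by
      have hθ3 : 0 < θ₁ ^ 3 := pow_pos hθ₁ 3
      have t1 : θ₁ ^ 2 ≤ 1 := pow_le_one₀ hθ₁.le hθ₁1
      have h5 : 2.5e10 / θ₁ ^ 3 * δ ≤ Λ' * δ := mul_le_mul_of_nonneg_right hΛ' hδ.le
      have h6 : 24 * rb ≤ 2.5e10 / θ₁ ^ 3 * δ := by
        rw [div_mul_eq_mul_div, le_div_iff₀ hθ3]
        have t2 : 24 * rb * θ₁ ^ 3 = 24 * (θ₁ * rb) * θ₁ ^ 2 := by ring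
        have t3 : 24 * (θ₁ * rb) * θ₁ ^ 2 ≤ 24 * (3 * δ) * θ₁ ^ 2 := by gcongr
        have t4 : 24 * (3 * δ) * θ₁ ^ 2 ≤ 24 * (3 * δ) * 1 := by gcongr
        linarith only [t2, t3, t4, hδ]
      linarith only [h5, h6]
    have s3 : 6 * rb / Λ' ≤ δ / 4 := by rw [div_le_iff₀ hΛ'pos]; linarith only [h4]
    linarith only [s1, s2, s3]
  exact ⟨b₂, rt, hF, hφb₂, hb₂R, hrb_lo, hrt, hrtd, hJrt, hrtb, hgap, hΛ4, hbig1, hbig2⟩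

/-! ### The points, floors and layer -/

set_option maxHeartbeats 400000 in
-- one long assembly of landed facts; the arithmetic is delegated to `CarterThresholdBarrierConstants`
/-- **Geometry of the threshold barrier.** For a tortoise radius `ρ` of a sub-extremal Kerr exterior,
an admissible triple at the threshold `ω = mω₊ ≠ 0` in a Breitenlohner–Freedman stable sector with
margin `θ₁ ∈ (0, 1]`, near extremality `r₊ − r₋ ≤ θ₁M/4`, a collar parameter `θ > 0` with
`θ(r₊ − r₋) ≤ θ₁M/4`, `Λ′ ≥ 2.5·10¹⁰/θ₁³`, and GIVEN the census: there are
`b₂, s_θ, s_lo, s_mid, L, K_L, k₀, k₁` with the forbidden half-line `{φ ≤ 0} = (−∞, b₂]`, `φ b₂ = 0`,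
`ρ b₂ < R`, `(1 + θ₁/2)r₊ ≤ ρ b₂`, `ρ s_θ = r₊ + θ(r₊ − r₋)`, `s_θ ≤ s_lo < s_mid ≤ b₂ − L`, `0 < L`,
the floors `k₀² ≤ V∘ρ − ω²` on `[s_θ, b₂ − L]`, `k₁² ≤ V∘ρ − ω²` on `[s_lo, s_mid]` (`k₀, k₁ > 0`), the
layer `|V∘ρ − ω²| ≤ K_L²` on `[b₂ − L, b₂]`, `K_L L ≤ 1`, and the bookkeeping facts
`(ρ b₂ − r₊)/4 ≤ s_mid − s_lo`, `ω²(ρ b₂ − r₊)⁵/(1024(ρ b₂)⁵) ≤ k₁²`,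
`min(Δ(r₊ + θ(r₊ − r₋))·ω²(ρ b₂ − r₊)/(32(ρ b₂)³), 3(ρ b₂ − r₊)²/(4(ρ b₂)⁴)) ≤ k₀²`,
`3ρ b₂/(ω²(ρ b₂ − r₊)²) ≤ L ≤ 92160ρ b₂/(ω²(ρ b₂ − r₊)²)`, `Λ′ ≤ 4ω²(ρ b₂)²`. [folklore] -/
theorem threshold_barrier_geometry (hρ : IsTortoiseRadius M a ρ) (hMa : IsSubextremal M a)
    (hadm : IsAdmissibleTriple a ω m Λ) (hωth : ω = m * horizonAngularVelocity M a) (hω : ω ≠ 0)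
    {θ₁ : ℝ} (hθ₁ : 0 < θ₁) (hθ₁1 : θ₁ ≤ 1)
    (hBF : (1 + θ₁) * (2 * rPlus M a * ω) ^ 2 ≤ Λ - 2 * a * m * ω)
    (hd : rPlus M a - rMinus M a ≤ θ₁ * M / 4)
    {θ : ℝ} (hθ : 0 < θ) (hθd : θ * (rPlus M a - rMinus M a) ≤ θ₁ * M / 4)
    (hΛ' : 2.5e10 / θ₁ ^ 3 ≤ Λ - 2 * a * m * ω)
    (hord : (Ioi (rPlus M a) ∩ {r : ℝ | ω ^ 2 ≤ sepPotential M a ω m Λ r}).OrdConnected) :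
    ∃ b₂ sθ slo smid L KL k₀ k₁ : ℝ,
      {s | ω ^ 2 - sepPotential M a ω m Λ (ρ s) ≤ 0} = Iic b₂ ∧
      ω ^ 2 - sepPotential M a ω m Λ (ρ b₂) = 0 ∧
      ρ b₂ < max (7 * M) (max (Real.sqrt (12 * Λ) / |ω|) (1 / (M * ω ^ 2))) ∧
      (1 + θ₁ / 2) * rPlus M a ≤ ρ b₂ ∧
      ρ sθ = rPlus M a + θ * (rPlus M a - rMinus M a) ∧
      sθ ≤ slo ∧ slo < smid ∧ smid ≤ b₂ - L ∧ 0 < L ∧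
      0 < k₀ ∧ (∀ s ∈ Icc sθ (b₂ - L), k₀ ^ 2 ≤ sepPotential M a ω m Λ (ρ s) - ω ^ 2) ∧
      0 < k₁ ∧ (∀ s ∈ Icc slo smid, k₁ ^ 2 ≤ sepPotential M a ω m Λ (ρ s) - ω ^ 2) ∧
      0 ≤ KL ∧ (∀ s ∈ Icc (b₂ - L) b₂, |sepPotential M a ω m Λ (ρ s) - ω ^ 2| ≤ KL ^ 2) ∧
      KL * L ≤ 1 ∧
      (ρ b₂ - rPlus M a) / 4 ≤ smid - slo ∧
      ω ^ 2 * (ρ b₂ - rPlus M a) ^ 5 / (1024 * ρ b₂ ^ 5) ≤ k₁ ^ 2 ∧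
      min (delta M a (rPlus M a + θ * (rPlus M a - rMinus M a)) *
          (ω ^ 2 * (ρ b₂ - rPlus M a) / (32 * ρ b₂ ^ 3)))
        (3 * (ρ b₂ - rPlus M a) ^ 2 / (4 * ρ b₂ ^ 4)) ≤ k₀ ^ 2 ∧
      3 * ρ b₂ / (ω ^ 2 * (ρ b₂ - rPlus M a) ^ 2) ≤ L ∧
      L ≤ 92160 * ρ b₂ / (ω ^ 2 * (ρ b₂ - rPlus M a) ^ 2) ∧
      Λ - 2 * a * m * ω ≤ 4 * ω ^ 2 * ρ b₂ ^ 2 := by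
  have ha : |a| < M := hMa
  have hM : 0 < M := hMa.pos
  have hrp : 0 < rPlus M a := rPlus_pos hM a
  have hMr : M ≤ rPlus M a := M_le_rPlus M a
  have hrm : rMinus M a < rPlus M a := hMa.rMinus_lt_rPlus
  have hω2 : 0 < ω ^ 2 := by positivity
  have ha2 : a ^ 2 ≤ rPlus M a ^ 2 := by
    have h1 : |a| ≤ rPlus M a := ha.le.trans hMr
    nlinarith [sq_abs a, abs_nonneg a]
  obtain ⟨b₂, rt, hF, hφb₂, hb₂R, hrb_lo, hrt, hrtd, hJrt, hrtb, hgap, hΛ4, hbig1, hbig2⟩ :=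
    threshold_barrier_radii hρ hMa hadm hωth hω hθ₁ hθ₁1 hBF hd hΛ' hord
  set rb := ρ b₂ with hrbdef
  set δ := rb - rPlus M a with hδdef
  set d := rPlus M a - rMinus M a with hddef
  have hd0 : 0 < d := sub_pos.2 hrm
  have hrbeq : rPlus M a + δ = rb := by rw [hδdef]; ring
  have hδlo : θ₁ * rPlus M a / 2 ≤ δ := by
    have e : (1 + θ₁ / 2) * rPlus M a = rPlus M a + θ₁ * rPlus M a / 2 := by ring
    rw [hδdef]; linarith only [hrb_lo, e]
  have hθM : θ₁ * M ≤ θ₁ * rPlus M a := mul_le_mul_of_nonneg_left hMr hθ₁.le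
  have hδM : θ₁ * M / 2 ≤ δ := by linarith only [hδlo, hθM]
  have hδ : 0 < δ := lt_of_lt_of_le (by positivity) hδM
  have hrb0 : 0 < rb := by linarith only [hδ, hδdef, hrp]
  have hdδ : d ≤ δ / 2 := by linarith only [hd, hδM, hddef]
  have hδrb : δ ≤ rb := by linarith only [hδdef, hrp]
  -- the three radii and their tortoise preimages
  have hrθp : rPlus M a < rPlus M a + θ * d := lt_add_of_pos_right _ (mul_pos hθ hd0)
  have hrlop : rPlus M a < rPlus M a + δ / 2 := by linarith only [hδ]
  have hrmidp : rPlus M a < rPlus M a + 3 * δ / 4 := by linarith only [hδ]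
  obtain ⟨sθ, hsθ⟩ := hρ.exists_apply_eq hrθp
  obtain ⟨slo, hslo⟩ := hρ.exists_apply_eq hrlop
  obtain ⟨smid, hsmid⟩ := hρ.exists_apply_eq hrmidp
  have hθlo : sθ ≤ slo := by
    rw [← hρ.le_iff_le hMa, hsθ, hslo]; linarith only [hθd, hδM, hddef]
  have hlomid : slo < smid := by
    rw [← hρ.lt_iff_lt hMa, hslo, hsmid]; linarith only [hδ]
  have hmidb : smid ≤ b₂ := by
    rw [← hρ.le_iff_le hMa, hsmid, ← hrbdef]; linarith only [hδdef, hδ]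
  have hℓ : δ / 4 ≤ smid - slo := by
    have h := hρ.apply_sub_apply_le_sub hMa hlomid.le
    rw [hslo, hsmid] at h; linarith only [h]
  have hℓ₂ : δ / 4 ≤ b₂ - smid := by
    have h := hρ.apply_sub_apply_le_sub hMa hmidb
    rw [hsmid, ← hrbdef] at h; linarith only [h, hδdef]
  -- the profile zero is in the outer half: `r_lo ≤ r_mid ≤ r_t ≤ r_b ≤ 2r_t + r₊`
  have hlot : rPlus M a + δ / 2 ≤ rt := by linarith only [hgap, hδdef, hδ]
  have hrt2 : rPlus M a + δ + rPlus M a ≤ 2 * (rt + rPlus M a) := by linarith only [hlot, hδ, hrp]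
  have hrtb' : rt ≤ rPlus M a + δ := by rw [hrbeq]; exact hrtb
  -- the affine bounds on `[s_lo, b₂]`, constants in abstract form
  have hV : sepPotential M a ω m Λ (ρ b₂) = ω ^ 2 := by linarith only [hφb₂]
  set c₁ := 2 * ω ^ 2 * (rPlus M a + δ / 2 + rPlus M a) *
      ((rPlus M a + δ / 2 - rPlus M a) / (rPlus M a + δ / 2 - rMinus M a)) *
      ((rPlus M a + δ / 2 - rPlus M a) * (rPlus M a + δ / 2 - rMinus M a)) ^ 2 /
      ((rPlus M a + δ) ^ 2 + a ^ 2) ^ 3 with hc₁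
  set e₁ := (rPlus M a + δ - rPlus M a) * (rPlus M a + δ - rMinus M a) *
      (6 * (rPlus M a + δ + rPlus M a) / (rt + rPlus M a) + 3) /
      ((rPlus M a + δ / 2) ^ 2 + a ^ 2) ^ 2 with he₁
  set c₂ := ω ^ 2 * (2 * (rt + rPlus M a) + (rt + rPlus M a) ^ 2 / (rPlus M a + δ / 2 - rMinus M a)) *
      ((rPlus M a + δ - rPlus M a) * (rPlus M a + δ - rMinus M a)) ^ 2 /
      ((rPlus M a + δ / 2) ^ 2 + a ^ 2) ^ 3 with hc₂
  set e₂ := 3 * ((rPlus M a + δ - rPlus M a) * (rPlus M a + δ - rMinus M a)) /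
      ((rPlus M a + δ / 2) ^ 2 + a ^ 2) ^ 2 with he₂
  have haff : ∀ s ∈ Icc slo b₂, c₁ * (b₂ - s) - e₁ ≤ sepPotential M a ω m Λ (ρ s) - ω ^ 2 ∧
      sepPotential M a ω m Λ (ρ s) - ω ^ 2 ≤ c₂ * (b₂ - s) + e₂ := by
    intro s hs
    have h := negCoeff_affine_bounds_tortoise_of_threshold (Λ := Λ) hρ hMa hωth hω hrt hrtd hJrt hV hs
    rw [hslo, ← hrbdef, ← hrbeq] at h
    simp only [delta_eq_mul ha.le] at h
    exact h
  -- monomial bounds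
  have hc₁ge : ω ^ 2 * δ ^ 4 / (128 * (rPlus M a + δ) ^ 5) ≤ c₁ :=
    thresholdBarrier_c₁_ge hrp hrm hδ ha2
  have hc₁le : c₁ ≤ ω ^ 2 * δ ^ 4 / (2 * (rPlus M a + δ) ^ 5) :=
    thresholdBarrier_c₁_le hrp hrm hδ hdδ
  have he₁ge : 3 * δ ^ 2 / (4 * (rPlus M a + δ) ^ 4) ≤ e₁ :=
    thresholdBarrier_e₁_ge hrp hrm hδ ha2 hrt
  have he₁le : e₁ ≤ 360 * δ ^ 2 / (rPlus M a + δ) ^ 4 :=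
    thresholdBarrier_e₁_le hrp hrm hδ hdδ hrt hrt2
  have hc₂le : c₂ ≤ 1728 * ω ^ 2 * δ ^ 3 / (rPlus M a + δ) ^ 4 :=
    thresholdBarrier_c₂_le hrp hrm hδ hdδ hrt hrtb'
  have he₂le : e₂ ≤ 72 * δ ^ 2 / (rPlus M a + δ) ^ 4 :=
    thresholdBarrier_e₂_le hrp hrm hδ hdδ
  rw [hrbeq] at hc₁ge hc₁le he₁ge he₁le hc₂le he₂le
  have hc₂0 : 0 ≤ c₂ := by
    have h1 : 0 < rt + rPlus M a := by linarith only [hrt, hrp]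
    have h2 : 0 < rPlus M a + δ / 2 - rMinus M a := by linarith only [hrm, hδ]
    have h3 : 0 < rPlus M a + δ / 2 := by linarith only [hrp, hδ]
    rw [hc₂]
    exact div_nonneg (mul_nonneg (mul_nonneg hω2.le (add_nonneg (by linarith only [h1])
      (div_nonneg (sq_nonneg _) h2.le))) (sq_nonneg _)) (by positivity)
  have he₂0 : 0 ≤ e₂ := by
    rw [he₂]
    have h3 : 0 < rPlus M a + δ / 2 := by linarith only [hrp, hδ]
    refine div_nonneg (mul_nonneg (by norm_num) (mul_nonneg ?_ ?_)) (by positivity)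
    · linarith only [hδ]
    · linarith only [hδ, hrm]
  clear_value c₁ e₁ c₂ e₂
  have hc₁0 : 0 < c₁ := lt_of_lt_of_le (by positivity) hc₁ge
  have he₁0 : 0 < e₁ := lt_of_lt_of_le (by positivity) he₁ge
  have h8 : 8 * e₁ ≤ c₁ * δ := thresholdBarrier_eight_e₁_le hδ hrb0 hc₁ge he₁le hbig1
  -- the Airy length
  set L := 2 * e₁ / c₁ with hLdef
  obtain ⟨hL1, hL2⟩ := thresholdBarrier_ratio_bounds hω hδ hrb0 hc₁ge hc₁le he₁ge he₁le
  rw [← hLdef] at hL1 hL2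
  have hL0 : 0 < L := by rw [hLdef]; positivity
  have hLδ : L ≤ δ / 4 := by
    rw [hLdef, div_le_iff₀ hc₁0]; linarith only [h8]
  have hmidβ : smid ≤ b₂ - L := by linarith only [hℓ₂, hLδ]
  have hcL : c₁ * L = 2 * e₁ := by rw [hLdef]; field_simp
  -- the layer constant
  have hlay : (c₂ * L + e₁ + e₂) * L ^ 2 ≤ 1 :=
    thresholdBarrier_layer_le_one hω hδ hrb0 hδrb hc₁ge hc₁le he₁ge he₁le hc₂le he₂le hLdef hbig2
  clear_value L
  have hKL2 : 0 ≤ c₂ * L + e₁ + e₂ := by nlinarith only [hc₂0, hL0, he₁0, he₂0]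
  set KL := Real.sqrt (c₂ * L + e₁ + e₂) with hKLdef
  have hKLsq : KL ^ 2 = c₂ * L + e₁ + e₂ := Real.sq_sqrt hKL2
  have hKL0 : 0 ≤ KL := Real.sqrt_nonneg _
  clear_value KL
  have hKLL : KL * L ≤ 1 := by
    have h1 : (KL * L) ^ 2 ≤ 1 := by rw [mul_pow, hKLsq]; linarith only [hlay]
    have h2 : 0 ≤ KL * L := mul_nonneg hKL0 hL0.le
    nlinarith only [h1, h2]
  -- the collar floor constant and `k₀`, `k₁`
  set F₀ := delta M a (rPlus M a + θ * d) *
      (2 * ω ^ 2 * (rPlus M a + δ / 2 + rPlus M a) *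
        ((rPlus M a + δ / 2 - rPlus M a) / (rPlus M a + δ / 2 - rMinus M a)) *
        (rt - (rPlus M a + δ / 2))) / ((rPlus M a + δ / 2) ^ 2 + a ^ 2) ^ 2 with hF₀
  have hΔθ : 0 < delta M a (rPlus M a + θ * d) := delta_pos ha.le hrθp
  -- `F₀ ≥ Δ(r_θ) ω² δ/(32 r_b³)`
  have hkey : ω ^ 2 * δ / (32 * rb ^ 3) ≤
      2 * ω ^ 2 * (rPlus M a + δ / 2 + rPlus M a) *
        ((rPlus M a + δ / 2 - rPlus M a) / (rPlus M a + δ / 2 - rMinus M a)) *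
        (rt - (rPlus M a + δ / 2)) / ((rPlus M a + δ / 2) ^ 2 + a ^ 2) ^ 2 := by
    -- `2ω²(r_lo + r₊)h_lo(r_t − r_lo)/(r_lo² + a²)² ≥ 2ω²(r_b/2)(1/2)(δ/4)/(4r_b⁴)`
    have h1 : rb / 2 ≤ rPlus M a + δ / 2 + rPlus M a := by linarith only [hrbeq, hrp]
    have h2 : 1 / 2 ≤ (rPlus M a + δ / 2 - rPlus M a) / (rPlus M a + δ / 2 - rMinus M a) := by
      rw [le_div_iff₀ (by linarith only [hrm, hδ])]; linarith only [hdδ, hddef]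
    have h3 : δ / 4 ≤ rt - (rPlus M a + δ / 2) := by linarith only [hgap, hδdef]
    have h4 : ((rPlus M a + δ / 2) ^ 2 + a ^ 2) ^ 2 ≤ 4 * rb ^ 4 := by
      have h5 : (rPlus M a + δ / 2) ^ 2 + a ^ 2 ≤ 2 * rb ^ 2 := by
        rw [← hrbeq]; nlinarith only [ha2, hδ, hrp]
      calc ((rPlus M a + δ / 2) ^ 2 + a ^ 2) ^ 2 ≤ (2 * rb ^ 2) ^ 2 :=
            pow_le_pow_left₀ (by positivity) h5 2
        _ = 4 * rb ^ 4 := by ring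
    have hA : 0 < ((rPlus M a + δ / 2) ^ 2 + a ^ 2) ^ 2 := by
      have : 0 < rPlus M a + δ / 2 := by linarith only [hrp, hδ]
      positivity
    calc ω ^ 2 * δ / (32 * rb ^ 3) = 2 * ω ^ 2 * (rb / 2) * (1 / 2) * (δ / 4) / (4 * rb ^ 4) := by
          field_simp; ring
      _ ≤ 2 * ω ^ 2 * (rPlus M a + δ / 2 + rPlus M a) *
            ((rPlus M a + δ / 2 - rPlus M a) / (rPlus M a + δ / 2 - rMinus M a)) *
            (rt - (rPlus M a + δ / 2)) / ((rPlus M a + δ / 2) ^ 2 + a ^ 2) ^ 2 := by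
          apply div_le_div₀ _ _ hA h4
          · exact mul_nonneg (mul_nonneg (mul_nonneg (by positivity) (by linarith only [h1, hrb0]))
              (le_trans (by norm_num) h2)) (by linarith only [h3, hδ])
          · gcongr
  have hF₀ge : delta M a (rPlus M a + θ * d) * (ω ^ 2 * δ / (32 * rb ^ 3)) ≤ F₀ := by
    calc delta M a (rPlus M a + θ * d) * (ω ^ 2 * δ / (32 * rb ^ 3))
        ≤ delta M a (rPlus M a + θ * d) *
          (2 * ω ^ 2 * (rPlus M a + δ / 2 + rPlus M a) *
            ((rPlus M a + δ / 2 - rPlus M a) / (rPlus M a + δ / 2 - rMinus M a)) *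
            (rt - (rPlus M a + δ / 2)) / ((rPlus M a + δ / 2) ^ 2 + a ^ 2) ^ 2) :=
          mul_le_mul_of_nonneg_left hkey hΔθ.le
      _ = F₀ := by rw [hF₀]; ring
  have hF₀pos : 0 < F₀ := lt_of_lt_of_le (by positivity) hF₀ge
  set k₀ := Real.sqrt (min F₀ e₁) with hk₀def
  have hmin0 : 0 < min F₀ e₁ := lt_min hF₀pos he₁0
  have hk₀sq : k₀ ^ 2 = min F₀ e₁ := Real.sq_sqrt hmin0.le
  have hk₀ : 0 < k₀ := Real.sqrt_pos.2 hmin0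
  set k₁ := Real.sqrt (c₁ * δ / 8) with hk₁def
  have hk₁sq : k₁ ^ 2 = c₁ * δ / 8 := Real.sq_sqrt (by positivity)
  have hk₁ : 0 < k₁ := Real.sqrt_pos.2 (by positivity)
  clear_value k₀ k₁
  -- floors
  have hfl₁ : ∀ s ∈ Icc slo smid, k₁ ^ 2 ≤ sepPotential M a ω m Λ (ρ s) - ω ^ 2 := by
    intro s hs
    have hs' : s ∈ Icc slo b₂ := ⟨hs.1, hs.2.trans hmidb⟩
    have h := (haff s hs').1
    have h1 : c₁ * (δ / 4) ≤ c₁ * (b₂ - s) :=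
      mul_le_mul_of_nonneg_left (by linarith only [hs.2, hℓ₂]) hc₁0.le
    rw [hk₁sq]; linarith only [h, h1, h8]
  have hLb : b₂ - L ≤ b₂ := by linarith only [hL0]
  have hflA : ∀ s ∈ Icc slo (b₂ - L), e₁ ≤ sepPotential M a ω m Λ (ρ s) - ω ^ 2 := by
    intro s hs
    have hs' : s ∈ Icc slo b₂ := ⟨hs.1, hs.2.trans hLb⟩
    have h := (haff s hs').1
    have h1 : c₁ * L ≤ c₁ * (b₂ - s) := mul_le_mul_of_nonneg_left (by linarith only [hs.2]) hc₁0.le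
    linarith only [h, h1, hcL]
  have hfl₀ : ∀ s ∈ Icc sθ (b₂ - L), k₀ ^ 2 ≤ sepPotential M a ω m Λ (ρ s) - ω ^ 2 := by
    intro s hs
    rw [hk₀sq]
    rcases le_or_gt s slo with h | h
    · -- collar floor
      have hθr : rPlus M a + θ * d ≤ ρ s := by rw [← hsθ]; exact (hρ.strictMono hMa).monotone hs.1
      have hrlo : ρ s ≤ rPlus M a + δ / 2 := by rw [← hslo]; exact (hρ.strictMono hMa).monotone h
      have hc := negCoeff_ge_of_collar (Λ := Λ) ha hωth hrθp hθr hrlo hlot hJrt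
      exact (min_le_left _ _).trans hc
    · exact (min_le_right _ _).trans (hflA s ⟨h.le, hs.2⟩)
  have hflL : ∀ s ∈ Icc (b₂ - L) b₂, |sepPotential M a ω m Λ (ρ s) - ω ^ 2| ≤ KL ^ 2 := by
    intro s hs
    have hslo' : slo ≤ s := by linarith only [hs.1, hmidβ, hlomid, hθlo]
    have hs' : s ∈ Icc slo b₂ := ⟨hslo', hs.2⟩
    obtain ⟨h1, h2⟩ := haff s hs'
    have h3 : c₂ * (b₂ - s) ≤ c₂ * L := mul_le_mul_of_nonneg_left (by linarith only [hs.1]) hc₂0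
    have h4 : 0 ≤ c₁ * (b₂ - s) := mul_nonneg hc₁0.le (by linarith only [hs.2])
    rw [hKLsq, abs_le]
    constructor <;> nlinarith only [h1, h2, h3, h4, he₁0, he₂0, hc₂0, hL0]
  refine ⟨b₂, sθ, slo, smid, L, KL, k₀, k₁, hF, hφb₂, hb₂R, hrb_lo, hsθ, hθlo, hlomid, hmidβ, hL0, hk₀,
    hfl₀, hk₁, hfl₁, hKL0, hflL, hKLL, hℓ, ?_, ?_, hL1, hL2, hΛ4⟩
  · rw [hk₁sq]
    have : ω ^ 2 * δ ^ 5 / (1024 * rb ^ 5) = ω ^ 2 * δ ^ 4 / (128 * rb ^ 5) * δ / 8 := by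
      field_simp; ring
    rw [this]
    exact div_le_div_of_nonneg_right (mul_le_mul_of_nonneg_right hc₁ge hδ.le) (by norm_num)
  · rw [hk₀sq]
    exact min_le_min hF₀ge he₁ge

end Geometry

end Kerr

end Literature.Geometry.Lorentzian

end
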